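import Summits.Ventures.CertifiedQuantumChemistry.Certificates.HubbardRingL4SectorDualSound
import HarnessLib

/-!
# Ventures/CertifiedQuantumChemistry — Certificates/HubbardRingL4SectorDualNoSpinRow.lean: the table-form dual certificate WITHOUT the
# spin row — soundness on the plain `(2,2)`-SECTOR DQG programme of the Hubbard 4-ring (`xi = 0` ⇒ `mu ≤ cd·Σ doublons + ch·Σ bonds` at
# every `IsDQGFeasibleSector 2 2 γ Γ`; the level-DQG companion of `Dual.le_of_check`)

HONEST FRAMING (verbatim): certified bounds for a stated model Hamiltonian in a stated basis; not a
claim about the real molecule beyond that model. A CERTIFICATE FORMAT statement: no model value, no row, no claim node.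

Seat rdm-B (gen 44). `Certificates/HubbardRingL4SectorDualSound.lean` proves weak duality for the singlet-restricted programme
(`IsDQGFeasibleSinglet`: the sector rows plus Mazziotti's exchange row (98), multiplier `xi`). A certificate that does not use the
exchange row (`d.xi = 0`) bounds the LARGER feasible set of the plain `S_z`-sector programme `IsDQGFeasibleSector 2 2` — the level
at which S-U's `c_DQG(4) = √2 − 1` is stated (`Model.pqgSectorEnergy`). **`Dual.le_of_check_sector`** (same proof, the exchange row
replaced by `xi = 0`) and **`Dual.mul_mu_le_pqgSectorEnergy`** (`U·mu ≤ Model.pqgSectorEnergy (hubbardRingTV 4 1 U) 2 2` for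
`cd = 1`, `ch = −2/U`). The explicit level-DQG certificate (value `−8 − 4√2`, tables over `ℚ(√2)`) is not in this file. 0 sorry, 0 def;
standard axioms.
-/

set_option linter.style.longLine false

namespace Summit.Ventures.CertifiedQuantumChemistry

namespace DualL4

open Matrix Finset
open Literature.MathematicalPhysics.QuantumLattice Literature.MathematicalPhysics.QuantumChemistry
open Summit.Ventures.CertifiedQuantumChemistry.Hamiltonians
open scoped ComplexOrder

/-- **SOUNDNESS WITHOUT THE SPIN ROW.** If `check = true`, `xi = 0` and the three dual tables are positive semidefinite, then at every
SECTOR-feasible pair `(γ, Γ)` of the `(2,2)` sector of the 4-ring: `mu ≤ cd·Σ_p Re Γ_{(p↑p↓),(p↑p↓)} + ch·Σ_{p,σ} Re γ_{pσ,(p+1)σ}`. -/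
theorem Dual.le_of_check_sector (d : Dual) (hc : d.check = true) (hxi : d.xi = 0) (hD : (Dual.realZ d.zD).PosSemidef) (hQ : (Dual.realZ d.zQ).PosSemidef)
    (hG : (Dual.realZ d.zG).PosSemidef) {γ : Matrix O4 O4 ℂ} {Γ : Matrix OP OP ℂ} (hs : IsDQGFeasibleSector 2 2 γ Γ) :
    (d.mu : ℝ) ≤ (d.cd : ℝ) * ∑ p : Fin 4, (Γ (orb p 0, orb p 1) (orb p 0, orb p 1)).re
      + (d.ch : ℝ) * ∑ p : Fin 4, ∑ σ : Fin 2, (γ (orb p σ) (orb (finRotate 4 p) σ)).re := by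
  have hq : IsDQGFeasible (2 + 2) γ Γ := hs.dqg
  -- pairings ≥ 0
  have pD := pairing_nonneg hD hq.d_psd
  have pQ := pairing_nonneg hQ hq.q_psd
  have pG := pairing_nonneg hG hq.g_psd
  rw [pairD_eq] at pD
  rw [pairQ_eq] at pQ
  rw [pairG_eq] at pG
  -- rows
  have rNu : ∑ P' : O4, ∑ k : O4, ∑ τ : Fin 2, ((d.nu P' k τ : ℚ) : ℝ) * ∑ y : Fin 4, (Γ (P', orb y τ) (k, orb y τ)).re =
      ∑ P' : O4, ∑ k : O4, ∑ τ : Fin 2, ((d.nu P' k τ : ℚ) : ℝ) * ((2 - (if τ = sp k then 1 else 0)) * (γ P' k).re) := by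
    refine Finset.sum_congr rfl fun P' _ => Finset.sum_congr rfl fun k _ => Finset.sum_congr rfl fun τ _ => ?_
    rw [e2_row hs]
  rw [nuRowsΓ_eq, nuRowsγ_eq] at rNu
  have rOne : ∑ i : O4, (γ i i).re = 4 := by
    have h := congrArg Complex.re hq.trace_one; rw [Complex.re_sum] at h; simpa using h
  have rUp : ∑ p : Fin 4, (γ (orb p 0) (orb p 0)).re = 2 := by
    have h := congrArg Complex.re hs.trace_up; rw [Complex.re_sum] at h; simpa using h
  have rDn : ∑ p : Fin 4, (γ (orb p 1) (orb p 1)).re = 2 := by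
    have h := congrArg Complex.re hs.trace_down; rw [Complex.re_sum] at h; simpa using h
  have rUU : ∑ x : Fin 4, ∑ y : Fin 4, (Γ (orb x 0, orb y 0) (orb x 0, orb y 0)).re = 2 := by
    have h := congrArg Complex.re hs.trace_upUp; simp only [Complex.re_sum] at h; push_cast at h; norm_num at h; exact h
  have rDD : ∑ x : Fin 4, ∑ y : Fin 4, (Γ (orb x 1, orb y 1) (orb x 1, orb y 1)).re = 2 := by
    have h := congrArg Complex.re hs.trace_downDown; simp only [Complex.re_sum] at h; push_cast at h; norm_num at h; exact h
  have rUD : ∑ x : Fin 4, ∑ y : Fin 4, (Γ (orb x 0, orb y 1) (orb x 0, orb y 1)).re = 4 := by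
    have h := congrArg Complex.re hs.trace_upDown; simp only [Complex.re_sum] at h; push_cast at h; norm_num at h; exact h
  have rEx : (d.xi : ℝ) * ∑ x : Fin 4, ∑ y : Fin 4, (Γ (orb x 0, orb y 1) (orb y 0, orb x 1)).re = 0 := by
    rw [hxi]; push_cast; ring
  have rEx' : (2 : ℝ) * d.xi = 0 := by rw [hxi]; push_cast; ring
  -- the identity: canonical defects vanish
  obtain ⟨hcΓ, hcγ, hc0⟩ := d.check_spec hc
  have zΓ : ∑ P : OP, ∑ R : OP, ((d.defΓ P R : ℚ) : ℝ) * (Γ P R).re = 0 := by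
    rw [sum_defΓ_canon d hq.d_psd.1 hq.swap_fst hq.swap_snd]
    have : ∀ P R : OP, d.cdefΓ P R = 0 := by
      rintro ⟨x, y⟩ ⟨u, v⟩
      rw [← orb_st_sp x, ← orb_st_sp y, ← orb_st_sp u, ← orb_st_sp v]
      exact hcΓ _ _ _ _ _ _ _ _
    simp [this]
  have zγ : ∑ x : O4, ∑ y : O4, ((d.defγ x y : ℚ) : ℝ) * (γ x y).re = 0 := by
    rw [sum_defγ_canon d hq.herm_one hs.spin_sel]
    have : ∀ x y : O4, d.cdefγ x y = 0 := by
      intro x y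
      rw [← orb_st_sp x, ← orb_st_sp y]
      exact hcγ _ _ _ _
    simp [this]
  have z0 : ((d.def0 : ℚ) : ℝ) = 0 := by rw [hc0]; push_cast; ring
  rw [sum_defΓ_eq, rUU, rDD, rUD, rEx] at zΓ
  rw [sum_defγ_eq, rOne, rUp, rDn] at zγ
  rw [def0_eq] at z0
  -- assemble: target − mu = Σ pairings (≥ 0) + Σ rows (= 0)
  linarith [pD, pQ, pG, rNu, zΓ, zγ, z0, rEx']


/-- **`U·mu ≤ E_PQG(hubbardRingTV 4 1 U; 2, 2)`** (the plain sector value, `Model.pqgSectorEnergy`) for a checked certificate with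
`xi = 0`, positive semidefinite tables, `cd = 1`, `ch = −2/U`, `U > 0`. -/
theorem Dual.mul_mu_le_pqgSectorEnergy (d : Dual) (hc : d.check = true) (hxi : d.xi = 0) (hD : (Dual.realZ d.zD).PosSemidef)
    (hQ : (Dual.realZ d.zQ).PosSemidef) (hG : (Dual.realZ d.zG).PosSemidef) {U : ℚ} (hU : 0 < U) (hcd : d.cd = 1)
    (hch : d.ch = -2 / U) :
    (U : ℝ) * (d.mu : ℝ) ≤ Model.pqgSectorEnergy (hubbardRingTV 4 1 U) 2 2 := by
  rw [Model.pqgSectorEnergy, le_pqgSectorEnergy_iff _ _ _ (by simp) (by simp)]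
  intro γ Γ hs
  have h := d.le_of_check_sector hc hxi hD hQ hG hs
  rw [RingEnergy.hubbardRingTV_re_rdmEnergy_eq_of_feasible (by norm_num) 1 U hs]
  rw [hcd, hch] at h
  push_cast at h
  have hU' : (0 : ℝ) < U := by exact_mod_cast hU
  have key : (U : ℝ) * (d.mu : ℝ) ≤ (U : ℝ) * (1 * ∑ p : Fin 4, (Γ (orb p 0, orb p 1) (orb p 0, orb p 1)).re
      + -2 / (U : ℝ) * ∑ p : Fin 4, ∑ σ : Fin 2, (γ (orb p σ) (orb (finRotate 4 p) σ)).re) :=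
    mul_le_mul_of_nonneg_left h hU'.le
  have e : (U : ℝ) * (1 * ∑ p : Fin 4, (Γ (orb p 0, orb p 1) (orb p 0, orb p 1)).re
      + -2 / (U : ℝ) * ∑ p : Fin 4, ∑ σ : Fin 2, (γ (orb p σ) (orb (finRotate 4 p) σ)).re) =
      -2 * ((1 : ℚ) : ℝ) * ∑ p : Fin 4, ∑ σ : Fin 2, (γ (orb p σ) (orb (finRotate 4 p) σ)).re
      + (U : ℝ) * ∑ p : Fin 4, (Γ (orb p 0, orb p 1) (orb p 0, orb p 1)).re := by
    push_cast; field_simp; ring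
  rw [← e]
  exact key

end DualL4

end Summit.Ventures.CertifiedQuantumChemistry
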